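import Summits.QuantumFields.BalabanUV.Beta.EriceRemainderEnclosureHistoryAutonomyComparisonAgeCompositionYoungPairCapRowsB
import Summits.QuantumFields.BalabanUV.Beta.EriceRemainderEnclosureHistoryAutonomyComparisonAgeCompositionYoungSeparatedAges

/-!
# EriceRemainderEnclosureHistoryAutonomyComparisonAgeCompositionYoungPairCapSeparatedAges — (E97c) route (N), first order: THE CENSUS YOUNG PAIR `{1, k₂}` AT
# EVERY `k₂` BELOW A ×61 CHAIN, ANY NUMBER OF AGES.  §1 turns the pure rows (E97a∕b) into the flow cap **`young_pair_load_le`**: along every box solution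
# of an isotone dominated memory with floor, `x_1(m) + x_{k₂}(m) ≤ 0.8333` at every pin for `2 ≤ k₂ ≤ 29` ((E94b) `young_pair_letters` + the row of `k₂`).
# §2 feeds it to the cluster cascade (E95c) as the youngest level's mass cap (`κ = 1∕5`: `0.8333·1.2 ≤ 1`; older caps `0.6142`, closure at `R₀ = 60`):
# `{1, k₂, k₃, …}` with `2 ≤ k₂ ≤ 29` below a ×60 chain.  §3 the union with (E96b) `flow_nonneg_youngest_separated_ages` (`k₂ ≥ 30`, ×61): the census
# young pair at EVERY `k₂ ≥ 2` below a ×61 chain (the ×92 of (E96b) `flow_nonneg_census_young_pair_every` lowered to the older closure's own constant);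
# four ages `{1, k₂, k₃, k₄}` with ANY `k₂`, `k₃ ≥ 61k₂`, `k₄ ≥ 61k₃`

Cell `pub-balaban`, β-function sub-cell, BINDER row D4 «RemainderConst leaves for Bałaban's split» (`HOME/BINDER-OWNERS.md`; owner lineage `b2b-balaban-beta-an4`;
this file by co-owner #2 lineage `b2b-balaban-beta-d4-p2`, generation 85), β-FLOW TEAM duty (1), FREEZE (0) honoured (def-free; nothing restated).

HONEST FRAMING (page 1, verbatim and binding).  *"Discharging BetaPertH makes Bałaban's UV stability UNCONDITIONAL — a real constructive-QFT result; it is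
NOT the continuum limit and NOT the Clay problem."*  THIS FILE DISCHARGES NOTHING OF THE KIND.  Elementary real algebra ∕ real analysis about ABSTRACT
functionals on a box ]0,γ]^ℕ with displayed floors, profiles and signs, and the FIRST-ORDER renewal objects of route (N) built from them — hypotheses of a
census, not facts; the form, signs, ages and moments of Bałaban's (1.22) limit functional are NOT PRINTED ([I] p. 298; GAPS G-t4-U2-1∕-2) and NOT asserted.
Row D4 class UNCHANGED (critical-path width 0; instance 0∕1; D4 DISCHARGE NO DATE).  HONEST DEPENDENCY: continuum YM on T⁴ ⇐ BetaPertH ∧ nine spine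
estimates (0/9 proved); BetaPertH ⇐ (D1) ∧ (D4) ∧ CAP+tail; G-an2-4 gates asym, D1 and NE2/3/4.

THE POINT (README `HOME/b2b-balaban-beta-d4-p2/g85/README.md` §6).  §2 is (E95d) `flow_nonneg_young_pair_separated_ages_param` with the pair cap taken as a
HYPOTHESIS (`hpaircap`) instead of (E92b)'s `√2∕(1+p₀)` — any typed cap `≤ 1∕(1+κ)` plugs in (`flow_nonneg_young_pair_separated_ages_of_cap`).  Uses (E97a∕b)
`pair_cap_row_2 … 29`, (E94b) `young_pair_letters`∕`load_le_of_sq`, (E95c) `renewal_nonneg_cluster_cascade`, (E95b) `old_read_variation_of_bound`∕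
`aggregate_eq_sum_ages`, (E96b) `flow_nonneg_youngest_separated_ages`, (E82a) `kernel_entry_le`∕`row_mass_le` BY NAME.  NOT CLAIMED: ratios below 61 above
`k₂` (near OLD pairs; all-near profiles); arbitrary dampings; anything nonlinear; anything printed — NOT B12 Thm 2, NOT BetaPertH, NOT continuum, NOT Clay.

WHAT IS PROVED ([folklore]; 0 `def`, 0 sorry).  §1 **`young_pair_load_le`** (`2 ≤ k₂ ≤ 29`: `x_1 + x_{k₂} ≤ 0.8333` along every flow).  §2
**`flow_nonneg_young_pair_separated_ages_of_cap`** (parametric: any pair cap `s₀` with `s₀(1+κ) ≤ 1`), **`flow_nonneg_young_pair_cap_separated_ages`**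
(`2 ≤ k₂ ≤ 29`, chain ×60).  §3 **`flow_nonneg_census_young_pair_every_sixtyone`** (`{1, k₂, k₃, …}`: ANY `k₂ ≥ 2`, `k_{j+1} ≥ 61k_j`, every `r`),
**`flow_nonneg_census_four_ages_sixtyone`** (`{1,k₂,k₃,k₄}`: `2 ≤ k₂`, `k₃ ≥ 61k₂`, `k₄ ≥ 61k₃`).
-/
noncomputable section
open Finset

namespace Summit.QuantumFields.BalabanUV.Beta.EriceRemainderEnclosureHistoryAutonomyComparisonAgeCompositionYoungPairCapSeparatedAges

open Literature.MathematicalPhysics.QuantumFieldTheory.Balaban1983to89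
open Literature.MathematicalPhysics.QuantumFieldTheory.Balaban1983to89.T4BetaStationary
open Literature.MathematicalPhysics.QuantumFieldTheory.Balaban1983to89.T4BetaFlowWellPosed
open Summit.QuantumFields.BalabanUV.Beta.EriceRemainderEnclosureHistoryAutonomyComparisonAgeCompositionYoungPairMoment (young_pair_letters load_le_of_sq)
open Summit.QuantumFields.BalabanUV.Beta.EriceRemainderEnclosureHistoryAutonomyComparisonAgeCompositionYoungestTailSumFlow (kernel_entry_le row_mass_le)
open Summit.QuantumFields.BalabanUV.Beta.EriceRemainderEnclosureHistoryAutonomyComparisonAgeCompositionSeparatedAges (old_read_variation_of_bound aggregate_eq_sum_ages)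
open Summit.QuantumFields.BalabanUV.Beta.EriceRemainderEnclosureHistoryAutonomyComparisonAgeCompositionClusterCascade (renewal_nonneg_cluster_cascade)
open Summit.QuantumFields.BalabanUV.Beta.EriceRemainderEnclosureHistoryAutonomyComparisonAgeCompositionYoungSeparatedAges (flow_nonneg_youngest_separated_ages)
open Summit.QuantumFields.BalabanUV.Beta.EriceRemainderEnclosureHistoryAutonomyComparisonAgeCompositionYoungPairCapRowsA
open Summit.QuantumFields.BalabanUV.Beta.EriceRemainderEnclosureHistoryAutonomyComparisonAgeCompositionYoungPairCapRowsB

variable {B : (ℕ → ℝ) → ℝ} {γ b gIR : ℝ} {L : ℕ → ℝ} {K : ℕ} {h g : ℕ → ℝ}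

/-! ## §1 The young-pair cap along flows -/

/-- **THE YOUNG-PAIR CAP ALONG FLOWS.**  Along every box solution of an isotone dominated memory with floor, for `2 ≤ j ≤ 29` (`j < K`):
`x_1(m) + x_j(m) = L_1h_{m+1}³∕2 + j·L_jh_{m+j}³∕2 ≤ 0.8333` at every pin ((E94b) `young_pair_letters` with the row's rational `ρ, ζ`, then
(E97a∕b) `pair_cap_row_j`). [folklore] -/
theorem young_pair_load_le (hmono : ∀ u v : ℕ → ℝ, SeqBox γ u → SeqBox γ v → (∀ j, u j ≤ v j) → B u ≤ B v)
    (hL : ∀ k, 0 ≤ L k) (hb : 0 < b) (hlo : ∀ u, SeqBox γ u → b ≤ B u) (hdom : ∀ u, SeqBox γ u → ∑ k ∈ range K, L k * u k ≤ B u)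
    (hh : SeqBox γ h) (hf : MemFlow B gIR h) {j : ℕ} (hj2 : 2 ≤ j) (hj29 : j ≤ 29) (hjK : j < K) (m : ℕ) :
    L 1 * h (m + 1) ^ 3 / 2 + (j : ℝ) * (L j * h (m + j) ^ 3 / 2) ≤ 8333 / 10000 := by
  have hpos : ∀ n, 0 < h n := fun n => (hh n).1
  have hx : 0 ≤ L 1 * h (m + 1) ^ 3 / 2 := by have := hL 1; have := hpos (m + 1); positivity
  have hy : 0 ≤ (j : ℝ) * (L j * h (m + j) ^ 3 / 2) := by have := hL j; have := hpos (m + j); positivity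
  interval_cases j
  · obtain ⟨h1, h2, h3, h4⟩ := young_pair_letters hmono hL hb hlo hdom hh hf (j := 2) (by norm_num) hjK (ρ := 2041 / 2500) (ζ := 7559 / 5000)
      (by norm_num) (by norm_num) m
    linarith [pair_cap_row_2 hx hy h1 h2 h3 h4]
  · obtain ⟨h1, h2, h3, h4⟩ := young_pair_letters hmono hL hb hlo hdom hh hf (j := 3) (by norm_num) hjK (ρ := 433 / 500) (ζ := 15491 / 10000)
      (by norm_num) (by norm_num) m
    linarith [pair_cap_row_3 hx hy h1 h2 h3 h4]
  · obtain ⟨h1, h2, h3, h4⟩ := young_pair_letters hmono hL hb hlo hdom hh hf (j := 4) (by norm_num) hjK (ρ := 559 / 625) (ζ := 15689 / 10000)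
      (by norm_num) (by norm_num) m
    linarith [pair_cap_row_4 hx hy h1 h2 h3 h4]
  · obtain ⟨h1, h2, h3, h4⟩ := young_pair_letters hmono hL hb hlo hdom hh hf (j := 5) (by norm_num) hjK (ρ := 1141 / 1250) (ζ := 15811 / 10000)
      (by norm_num) (by norm_num) m
    linarith [pair_cap_row_5 hx hy h1 h2 h3 h4]
  · obtain ⟨h1, h2, h3, h4⟩ := young_pair_letters hmono hL hb hlo hdom hh hf (j := 6) (by norm_num) hjK (ρ := 4629 / 5000) (ζ := 7947 / 5000)
      (by norm_num) (by norm_num) m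
    linarith [pair_cap_row_6 hx hy h1 h2 h3 h4]
  · obtain ⟨h1, h2, h3, h4⟩ := young_pair_letters hmono hL hb hlo hdom hh hf (j := 7) (by norm_num) hjK (ρ := 4677 / 5000) (ζ := 7977 / 5000)
      (by norm_num) (by norm_num) m
    linarith [pair_cap_row_7 hx hy h1 h2 h3 h4]
  · obtain ⟨h1, h2, h3, h4⟩ := young_pair_letters hmono hL hb hlo hdom hh hf (j := 8) (by norm_num) hjK (ρ := 2357 / 2500) (ζ := 8 / 5)
      (by norm_num) (by norm_num) m
    linarith [pair_cap_row_8 hx hy h1 h2 h3 h4]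
  · obtain ⟨h1, h2, h3, h4⟩ := young_pair_letters hmono hL hb hlo hdom hh hf (j := 9) (by norm_num) hjK (ρ := 4743 / 5000) (ζ := 3207 / 2000)
      (by norm_num) (by norm_num) m
    linarith [pair_cap_row_9 hx hy h1 h2 h3 h4]
  · obtain ⟨h1, h2, h3, h4⟩ := young_pair_letters hmono hL hb hlo hdom hh hf (j := 10) (by norm_num) hjK (ρ := 4767 / 5000) (ζ := 1004 / 625)
      (by norm_num) (by norm_num) m
    linarith [pair_cap_row_10 hx hy h1 h2 h3 h4]
  · obtain ⟨h1, h2, h3, h4⟩ := young_pair_letters hmono hL hb hlo hdom hh hf (j := 11) (by norm_num) hjK (ρ := 4787 / 5000) (ζ := 16087 / 10000)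
      (by norm_num) (by norm_num) m
    linarith [pair_cap_row_11 hx hy h1 h2 h3 h4]
  · obtain ⟨h1, h2, h3, h4⟩ := young_pair_letters hmono hL hb hlo hdom hh hf (j := 12) (by norm_num) hjK (ρ := 9607 / 10000) (ζ := 16107 / 10000)
      (by norm_num) (by norm_num) m
    linarith [pair_cap_row_12 hx hy h1 h2 h3 h4]
  · obtain ⟨h1, h2, h3, h4⟩ := young_pair_letters hmono hL hb hlo hdom hh hf (j := 13) (by norm_num) hjK (ρ := 2409 / 2500) (ζ := 4031 / 2500)
      (by norm_num) (by norm_num) m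
    linarith [pair_cap_row_13 hx hy h1 h2 h3 h4]
  · obtain ⟨h1, h2, h3, h4⟩ := young_pair_letters hmono hL hb hlo hdom hh hf (j := 14) (by norm_num) hjK (ρ := 483 / 500) (ζ := 8069 / 5000)
      (by norm_num) (by norm_num) m
    linarith [pair_cap_row_14 hx hy h1 h2 h3 h4]
  · obtain ⟨h1, h2, h3, h4⟩ := young_pair_letters hmono hL hb hlo hdom hh hf (j := 15) (by norm_num) hjK (ρ := 4841 / 5000) (ζ := 16151 / 10000)
      (by norm_num) (by norm_num) m
    linarith [pair_cap_row_15 hx hy h1 h2 h3 h4]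
  · obtain ⟨h1, h2, h3, h4⟩ := young_pair_letters hmono hL hb hlo hdom hh hf (j := 16) (by norm_num) hjK (ρ := 9701 / 10000) (ζ := 8081 / 5000)
      (by norm_num) (by norm_num) m
    linarith [pair_cap_row_16 hx hy h1 h2 h3 h4]
  · obtain ⟨h1, h2, h3, h4⟩ := young_pair_letters hmono hL hb hlo hdom hh hf (j := 17) (by norm_num) hjK (ρ := 4859 / 5000) (ζ := 4043 / 2500)
      (by norm_num) (by norm_num) m
    linarith [pair_cap_row_17 hx hy h1 h2 h3 h4]
  · obtain ⟨h1, h2, h3, h4⟩ := young_pair_letters hmono hL hb hlo hdom hh hf (j := 18) (by norm_num) hjK (ρ := 9733 / 10000) (ζ := 809 / 500)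
      (by norm_num) (by norm_num) m
    linarith [pair_cap_row_18 hx hy h1 h2 h3 h4]
  · obtain ⟨h1, h2, h3, h4⟩ := young_pair_letters hmono hL hb hlo hdom hh hf (j := 19) (by norm_num) hjK (ρ := 4873 / 5000) (ζ := 4047 / 2500)
      (by norm_num) (by norm_num) m
    linarith [pair_cap_row_19 hx hy h1 h2 h3 h4]
  · obtain ⟨h1, h2, h3, h4⟩ := young_pair_letters hmono hL hb hlo hdom hh hf (j := 20) (by norm_num) hjK (ρ := 9759 / 10000) (ζ := 3239 / 2000)
      (by norm_num) (by norm_num) m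
    linarith [pair_cap_row_20 hx hy h1 h2 h3 h4]
  · obtain ⟨h1, h2, h3, h4⟩ := young_pair_letters hmono hL hb hlo hdom hh hf (j := 21) (by norm_num) hjK (ρ := 977 / 1000) (ζ := 16201 / 10000)
      (by norm_num) (by norm_num) m
    linarith [pair_cap_row_21 hx hy h1 h2 h3 h4]
  · obtain ⟨h1, h2, h3, h4⟩ := young_pair_letters hmono hL hb hlo hdom hh hf (j := 22) (by norm_num) hjK (ρ := 489 / 500) (ζ := 16207 / 10000)
      (by norm_num) (by norm_num) m
    linarith [pair_cap_row_22 hx hy h1 h2 h3 h4]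
  · obtain ⟨h1, h2, h3, h4⟩ := young_pair_letters hmono hL hb hlo hdom hh hf (j := 23) (by norm_num) hjK (ρ := 9789 / 10000) (ζ := 4053 / 2500)
      (by norm_num) (by norm_num) m
    linarith [pair_cap_row_23 hx hy h1 h2 h3 h4]
  · obtain ⟨h1, h2, h3, h4⟩ := young_pair_letters hmono hL hb hlo hdom hh hf (j := 24) (by norm_num) hjK (ρ := 9797 / 10000) (ζ := 16217 / 10000)
      (by norm_num) (by norm_num) m
    linarith [pair_cap_row_24 hx hy h1 h2 h3 h4]
  · obtain ⟨h1, h2, h3, h4⟩ := young_pair_letters hmono hL hb hlo hdom hh hf (j := 25) (by norm_num) hjK (ρ := 1961 / 2000) (ζ := 8111 / 5000)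
      (by norm_num) (by norm_num) m
    linarith [pair_cap_row_25 hx hy h1 h2 h3 h4]
  · obtain ⟨h1, h2, h3, h4⟩ := young_pair_letters hmono hL hb hlo hdom hh hf (j := 26) (by norm_num) hjK (ρ := 9813 / 10000) (ζ := 8113 / 5000)
      (by norm_num) (by norm_num) m
    linarith [pair_cap_row_26 hx hy h1 h2 h3 h4]
  · obtain ⟨h1, h2, h3, h4⟩ := young_pair_letters hmono hL hb hlo hdom hh hf (j := 27) (by norm_num) hjK (ρ := 9819 / 10000) (ζ := 1623 / 1000)
      (by norm_num) (by norm_num) m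
    linarith [pair_cap_row_27 hx hy h1 h2 h3 h4]
  · obtain ⟨h1, h2, h3, h4⟩ := young_pair_letters hmono hL hb hlo hdom hh hf (j := 28) (by norm_num) hjK (ρ := 4913 / 5000) (ζ := 16233 / 10000)
      (by norm_num) (by norm_num) m
    linarith [pair_cap_row_28 hx hy h1 h2 h3 h4]
  · obtain ⟨h1, h2, h3, h4⟩ := young_pair_letters hmono hL hb hlo hdom hh hf (j := 29) (by norm_num) hjK (ρ := 9831 / 10000) (ζ := 4059 / 2500)
      (by norm_num) (by norm_num) m
    linarith [pair_cap_row_29 hx hy h1 h2 h3 h4]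

/-! ## §2 The pair below a separated chain, the cap as a hypothesis -/

/-- **A YOUNG PAIR WITH A TYPED MASS CAP BELOW A SEPARATED CHAIN — PARAMETRIC FORM.**  As (E95d) `flow_nonneg_young_pair_separated_ages_param`, but the
pair cap is a HYPOTHESIS: `x_1(q) + x_{a 0}(q) ≤ s₀` at every pin with `s₀(1+κ) ≤ 1`; older closure `κ + 4·0.6142·(1+κ) ≤ R₀(1 − 0.6142(1+κ))κ`, `R₀ ≥ 28`;
profile `{1, a 0, …, a (r−1)}` with `2 ≤ a 0`, `R₀·a j ≤ a (j+1)`.  THEN `0 ≤ ε ≤ e` at every pin ((E95c) `renewal_nonneg_cluster_cascade`). [folklore] -/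
theorem flow_nonneg_young_pair_separated_ages_of_cap
    (hmono : ∀ u v : ℕ → ℝ, SeqBox γ u → SeqBox γ v → (∀ j, u j ≤ v j) → B u ≤ B v)
    (hL : ∀ k, 0 ≤ L k) (hb : 0 < b) (hlo : ∀ u, SeqBox γ u → b ≤ B u) (hdom : ∀ u, SeqBox γ u → ∑ k ∈ range K, L k * u k ≤ B u)
    (hh : SeqBox γ h) (hf : MemFlow B gIR h) (hg : ∀ t, 0 < g t ∧ g t ≤ 1)
    (hgF : ∀ t, 1 ≤ g t * (1 + ∑ k ∈ range K, L k * h (t + k) ^ 3 / 2))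
    {κ s₀ : ℝ} {R₀ : ℕ} (hκ : 0 < κ) (hsC : (6142 / 10000 : ℝ) * (1 + κ) < 1)
    (hR : κ + 4 * (6142 / 10000 : ℝ) * (1 + κ) ≤ (R₀ : ℝ) * (1 - (6142 / 10000 : ℝ) * (1 + κ)) * κ) (hR28 : 28 ≤ R₀)
    (hs₀C : s₀ * (1 + κ) ≤ 1)
    {r : ℕ} {a : ℕ → ℕ} (hr : 1 ≤ r) (ha0 : 2 ≤ a 0)
    (hpaircap : ∀ q, L 1 * h (q + 1) ^ 3 / 2 + (a 0 : ℝ) * (L (a 0) * h (q + a 0) ^ 3 / 2) ≤ s₀) (haK : a (r - 1) < K)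
    (hsep : ∀ j, j + 1 < r → R₀ * a j ≤ a (j + 1)) (hLa : ∀ l, l < K → l ≠ 1 → (∀ j, j < r → l ≠ a j) → L l = 0)
    {N : ℕ} {KL : ℕ → ℕ → ℕ → ℝ}
    (hKL : ∀ k n l, KL k n l = if 0 < k ∧ k < K ∧ l < k then L k * h (n + k) ^ 3 / 2 * ∏ t ∈ Ico (n + 1 + l) (n + k + 1), g t else 0)
    {KA : ℕ → ℕ → ℕ → ℝ} {RA : ℕ → (ℕ → ℝ) → ℕ → ℝ}
    (hRA : ∀ i v m, RA i v m = ∑ l ∈ range K, KA i m l * v (m + 1 + l))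
    (hKA : ∀ i m l, KA i m l = KL i m l + KA (i + 1) m l) (hKAtop : ∀ m l, KA K m l = 0)
    {e ε : ℕ → ℝ} (he0 : ∀ m, 0 ≤ e m) (hea : ∀ m, e (m + 1) ≤ e m)
    (hεt : ∀ m, N < m → ε m = 0) (hεrec : ∀ m, ε m = e m - RA 1 ε m) : ∀ m, 0 ≤ ε m ∧ ε m ≤ e m := by
  have hpos : ∀ n, 0 < h n := fun n => (hh n).1
  have hR1 : 1 ≤ R₀ := by omega
  -- the chain of older ages: monotone, strictly increasing, below K, ≥ 56 from level 1 on
  have hamono : ∀ i j, i ≤ j → j < r → a i ≤ a j := by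
    intro i j hij hjr
    induction j, hij using Nat.le_induction with
    | base => exact le_rfl
    | succ j _ ih =>
      have h1 := ih (by omega); have h2 := hsep j hjr
      have h3 : a j ≤ R₀ * a j := Nat.le_mul_of_pos_left _ (by omega)
      omega
  have hapos : ∀ j, j < r → 2 ≤ a j := fun j hj => ha0.trans (hamono 0 j (Nat.zero_le j) hj)
  have hastrict : ∀ i j, i < j → j < r → a i < a j := by
    intro i j hij hjr
    have h1 := hamono i (j - 1) (by omega) (by omega)
    have h2 := hsep (j - 1) (by omega)
    have h3 := hapos (j - 1) (by omega)
    rw [Nat.sub_add_cancel (by omega)] at h2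
    have h4 : a (j - 1) < R₀ * a (j - 1) := by nlinarith
    omega
  have hajK : ∀ j, j < r → a j < K := fun j hj => lt_of_le_of_lt (hamono j (r - 1) (by omega) (by omega)) haK
  have haold : ∀ j, 1 ≤ j → j < r → 56 ≤ a j := by
    intro j hj hjr
    have h2 := hsep (j - 1) (by omega)
    have h3 := hapos (j - 1) (by omega)
    rw [Nat.sub_add_cancel hj] at h2
    nlinarith
  have hainj : ∀ i j, i < r → j < r → a i = a j → i = j := by
    intro i j hi hj hij
    by_contra hne
    rcases Nat.lt_or_gt_of_ne hne with h' | h'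
    · exact absurd hij (ne_of_lt (hastrict i j h' hj))
    · exact absurd hij.symm (ne_of_lt (hastrict j i h' hi))
  have hK : 1 < K := by have := hajK 0 (by omega); have := hapos 0 (by omega); omega
  have hL0 : L 0 = 0 := hLa 0 (by omega) (by omega) fun j hj h0 => by have := hapos j hj; omega
  -- the extended age map: 1, a 0, a 1, …
  obtain ⟨at', hat'⟩ : ∃ at' : ℕ → ℕ, ∀ i, at' i = if i = 0 then 1 else a (i - 1) := ⟨_, fun _ => rfl⟩
  have hat0 : at' 0 = 1 := by rw [hat']; simp
  have hatS : ∀ j, at' (j + 1) = a j := fun j => by rw [hat']; simp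
  have hagg : ∀ q l, KA 1 q l = KL 1 q l + ∑ j ∈ range r, KL (a j) q l := by
    intro q l
    have h1 := aggregate_eq_sum_ages (L := L) (h := h) (g := g) hKL hKA hKAtop hK.le (r := r + 1) (a := at')
      (fun i hi => by
        rcases Nat.eq_zero_or_pos i with rfl | hip
        · rw [hat0]; exact ⟨Nat.one_pos, hK⟩
        · obtain ⟨j, rfl⟩ : ∃ j, i = j + 1 := ⟨i - 1, by omega⟩
          rw [hatS]; exact ⟨by have := hapos j (by omega); omega, hajK j (by omega)⟩)
      (fun i i' hi hi' hii' => by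
        rcases Nat.eq_zero_or_pos i with rfl | hip <;> rcases Nat.eq_zero_or_pos i' with rfl | hip'
        · rfl
        · obtain ⟨j', rfl⟩ : ∃ j', i' = j' + 1 := ⟨i' - 1, by omega⟩
          rw [hat0, hatS] at hii'; have := hapos j' (by omega); omega
        · obtain ⟨j, rfl⟩ : ∃ j, i = j + 1 := ⟨i - 1, by omega⟩
          rw [hat0, hatS] at hii'; have := hapos j (by omega); omega
        · obtain ⟨j, rfl⟩ : ∃ j, i = j + 1 := ⟨i - 1, by omega⟩
          obtain ⟨j', rfl⟩ : ∃ j', i' = j' + 1 := ⟨i' - 1, by omega⟩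
          rw [hatS, hatS] at hii'
          rw [hainj j j' (by omega) (by omega) hii'])
      (fun l' hl' hne => hLa l' hl' (by have := hne 0 (by omega); rwa [hat0] at this)
        (fun j hj => by have := hne (j + 1) (by omega); rwa [hatS] at this)) q l
    rw [h1, sum_range_succ']
    simp only [hatS, hat0]
    ring
  -- level data: level 0 = the pair {1, a 0}; level j ≥ 1 = the age a j
  obtain ⟨w, hw⟩ : ∃ w : ℕ → ℕ → ℕ → ℝ, ∀ j q l, w j q l = KL (a j) q l + if j = 0 then KL 1 q l else 0 := ⟨_, fun _ _ _ => rfl⟩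
  obtain ⟨x, hx⟩ : ∃ x : ℕ → ℕ → ℝ, ∀ j q, x j q = (a j : ℝ) * (L (a j) * h (q + a j) ^ 3 / 2)
      + if j = 0 then (1 : ℝ) * (L 1 * h (q + 1) ^ 3 / 2) else 0 := ⟨_, fun _ _ => rfl⟩
  obtain ⟨O, hO⟩ : ∃ O : ℕ → ℕ → ℝ, ∀ j q, O j q = ∑ l ∈ range K, w j q l * ε (q + 1 + l) := ⟨_, fun _ _ => rfl⟩
  have hc0 : ∀ k q, 0 ≤ L k * h (q + k) ^ 3 / 2 := fun k q => by have := hL k; have := hpos (q + k); positivity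
  -- the recursion with the level reads displayed
  have hrec : ∀ q, ε q = e q - ∑ j ∈ range r, O j q := by
    intro q
    rw [hεrec q, hRA]
    have h1 : ∑ j ∈ range r, O j q = ∑ l ∈ range K, (∑ j ∈ range r, w j q l) * ε (q + 1 + l) := by
      simp_rw [hO, sum_mul]; rw [sum_comm]
    have h2 : ∀ l, ∑ j ∈ range r, w j q l = KA 1 q l := by
      intro l
      simp_rw [hw, sum_add_distrib, sum_ite_eq' (range r) 0, if_pos (mem_range.mpr (by omega : 0 < r))]
      rw [hagg]; ring
    rw [h1]
    simp_rw [h2]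
  refine renewal_nonneg_cluster_cascade (r := r) (N := N) (Kw := K) (R₀ := R₀) (κ := κ) (s₀ := s₀)
    (s := 6142 / 10000) (lo := fun j => if j = 0 then 1 else a j) (hi := a) (w := w) (x := x)
    (ν := fun j q => 4 * (L (a j) * h (q + a j) ^ 3 / 2)) (O := O) (e := e) (ε := ε)
    hκ (by norm_num) hs₀C hsC hR (fun j hj => ?_) (fun j hj1 _ => by simp [if_neg (by omega : j ≠ 0)])
    (fun j q l => ?_) (fun j q l hl => ?_) (fun j q => ?_) (fun j q => by have := hc0 (a j) q; positivity)
    (fun j q hj => ?_) (fun q => ?_) (fun j q hj1 hjr => ?_) (fun j q hj1 _ => ?_) hO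
    (fun j m d T hj1 hjr hd1 hdj hT hnn hle => ?_) he0 hea hεt hrec
  · -- separation R₀·hi j ≤ lo (j+1) = a (j+1)
    simp only [if_neg (Nat.succ_ne_zero j)]
    exact hsep j hj
  · -- weights are non-negative
    rw [hw]
    refine add_nonneg (kernel_entry_le hL hh hg hKL (a j) q l).1 ?_
    split_ifs
    · exact (kernel_entry_le hL hh hg hKL 1 q l).1
    · exact le_rfl
  · -- weights vanish beyond the window a j
    rw [hw, hKL (a j), if_neg (by omega)]
    split_ifs with hj
    · rw [hKL, if_neg (by have := hapos 0 (by omega); subst hj; omega)]; simp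
    · simp
  · -- masses are non-negative
    rw [hx]
    refine add_nonneg (mul_nonneg (Nat.cast_nonneg _) (hc0 _ _)) ?_
    split_ifs
    · rw [one_mul]; exact hc0 1 q
    · exact le_rfl
  · -- row sums ≤ mass
    rw [hx]
    simp_rw [hw, sum_add_distrib]
    refine add_le_add (row_mass_le hL hh hg hKL (hajK j hj) q) ?_
    split_ifs
    · simpa using row_mass_le hL hh hg hKL hK q
    · simp
  · -- the young pair's mass cap (hypothesis)
    rw [hx, if_pos rfl, one_mul, add_comm]
    exact hpaircap q
  · -- the older caps: 3k + 1 ≤ 8k·0.6142² for k ≥ 56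
    rw [hx, if_neg (by omega), add_zero]
    have hk56 : (56 : ℝ) ≤ a j := by exact_mod_cast haold j hj1 hjr
    exact load_le_of_sq hmono hL hb hlo hdom hh hf (by have := hapos j hjr; omega) (hajK j hjr) (by norm_num) (by nlinarith) q
  · -- lo·ν ≤ 4x for the older levels
    rw [hx]
    simp only [if_neg (show j ≠ 0 by omega), add_zero]
    nlinarith [hc0 (a j) q]
  · -- the relative variation of the read of the age a j (j ≥ 1)
    have hO' : ∀ q, O j q = ∑ l ∈ range K, KL (a j) q l * ε (q + 1 + l) := fun q => by
      rw [hO]; exact sum_congr rfl fun l _ => by rw [hw, if_neg (by omega), add_zero]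
    rw [hO', hO']
    simp only [if_neg (by omega : j ≠ 0)] at hdj
    have hv := old_read_variation_of_bound hmono hL hb hlo hdom hh hf hL0 hg hgF hKL (by have := hapos j hjr; omega) (hajK j hjr)
      hd1 hdj hT hnn hle
    have e1 : 4 * (d : ℝ) * (L (a j) * h (m + a j) ^ 3 / 2) * T = 4 * (L (a j) * h (m + a j) ^ 3 / 2) * d * T := by ring
    simpa only [e1] using hv

/-- **THE CENSUS YOUNG PAIR `{1, k₂}`, `2 ≤ k₂ ≤ 29`, BELOW A ×60 CHAIN, ANY NUMBER OF AGES** (`κ = 1∕5`, cap `0.8333` from §1). [folklore] -/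
theorem flow_nonneg_young_pair_cap_separated_ages
    (hmono : ∀ u v : ℕ → ℝ, SeqBox γ u → SeqBox γ v → (∀ j, u j ≤ v j) → B u ≤ B v)
    (hL : ∀ k, 0 ≤ L k) (hb : 0 < b) (hlo : ∀ u, SeqBox γ u → b ≤ B u) (hdom : ∀ u, SeqBox γ u → ∑ k ∈ range K, L k * u k ≤ B u)
    (hh : SeqBox γ h) (hf : MemFlow B gIR h) (hg : ∀ t, 0 < g t ∧ g t ≤ 1)
    (hgF : ∀ t, 1 ≤ g t * (1 + ∑ k ∈ range K, L k * h (t + k) ^ 3 / 2))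
    {r : ℕ} {a : ℕ → ℕ} (hr : 1 ≤ r) (ha0 : 2 ≤ a 0) (ha29 : a 0 ≤ 29) (haK : a (r - 1) < K)
    (hsep : ∀ j, j + 1 < r → 60 * a j ≤ a (j + 1)) (hLa : ∀ l, l < K → l ≠ 1 → (∀ j, j < r → l ≠ a j) → L l = 0)
    {N : ℕ} {KL : ℕ → ℕ → ℕ → ℝ}
    (hKL : ∀ k n l, KL k n l = if 0 < k ∧ k < K ∧ l < k then L k * h (n + k) ^ 3 / 2 * ∏ t ∈ Ico (n + 1 + l) (n + k + 1), g t else 0)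
    {KA : ℕ → ℕ → ℕ → ℝ} {RA : ℕ → (ℕ → ℝ) → ℕ → ℝ}
    (hRA : ∀ i v m, RA i v m = ∑ l ∈ range K, KA i m l * v (m + 1 + l))
    (hKA : ∀ i m l, KA i m l = KL i m l + KA (i + 1) m l) (hKAtop : ∀ m l, KA K m l = 0)
    {e ε : ℕ → ℝ} (he0 : ∀ m, 0 ≤ e m) (hea : ∀ m, e (m + 1) ≤ e m)
    (hεt : ∀ m, N < m → ε m = 0) (hεrec : ∀ m, ε m = e m - RA 1 ε m) : ∀ m, 0 ≤ ε m ∧ ε m ≤ e m := by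
  have ha0K : a 0 < K := by
    have h1 : a 0 ≤ a (r - 1) := by
      have hmono : ∀ n, n < r → a 0 ≤ a n := by
        intro n hn
        induction n with
        | zero => exact le_rfl
        | succ n ih => have h1 := ih (by omega); have h2 := hsep n hn; omega
      exact hmono (r - 1) (by omega)
    omega
  exact flow_nonneg_young_pair_separated_ages_of_cap hmono hL hb hlo hdom hh hf hg hgF (κ := 1 / 5) (s₀ := 8333 / 10000) (R₀ := 60)
    (by norm_num) (by norm_num) (by norm_num) (by norm_num) (by norm_num) hr ha0
    (fun q => young_pair_load_le hmono hL hb hlo hdom hh hf ha0 ha29 ha0K q) haK hsep hLa hKL hRA hKA hKAtop he0 hea hεt hεrec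

/-! ## §3 The census young pair at every k₂ below a ×61 chain -/

/-- **THE CENSUS YOUNG PAIR `{1, k₂}` AT EVERY `k₂` BELOW A ×61 CHAIN, ANY NUMBER OF AGES.**  Profile carried by `{1, a 0, a 1, …, a (r−1)}` with
`a 0 = k₂ ≥ 2` ARBITRARY and `61·a j ≤ a (j+1)`: `0 ≤ ε ≤ e` at every pin, every horizon, every damping of the self-consistent class.  (`k₂ ≤ 29`: §2;
`k₂ ≥ 30`: (E96b) `flow_nonneg_youngest_separated_ages` with the ages `1, a 0, a 1, …`.) [folklore] -/
theorem flow_nonneg_census_young_pair_every_sixtyone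
    (hmono : ∀ u v : ℕ → ℝ, SeqBox γ u → SeqBox γ v → (∀ j, u j ≤ v j) → B u ≤ B v)
    (hL : ∀ k, 0 ≤ L k) (hb : 0 < b) (hlo : ∀ u, SeqBox γ u → b ≤ B u) (hdom : ∀ u, SeqBox γ u → ∑ k ∈ range K, L k * u k ≤ B u)
    (hh : SeqBox γ h) (hf : MemFlow B gIR h) (hg : ∀ t, 0 < g t ∧ g t ≤ 1)
    (hgF : ∀ t, 1 ≤ g t * (1 + ∑ k ∈ range K, L k * h (t + k) ^ 3 / 2))
    {r : ℕ} {a : ℕ → ℕ} (hr : 1 ≤ r) (ha0 : 2 ≤ a 0) (haK : a (r - 1) < K)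
    (hsep : ∀ j, j + 1 < r → 61 * a j ≤ a (j + 1)) (hLa : ∀ l, l < K → l ≠ 1 → (∀ j, j < r → l ≠ a j) → L l = 0)
    {N : ℕ} {KL : ℕ → ℕ → ℕ → ℝ}
    (hKL : ∀ k n l, KL k n l = if 0 < k ∧ k < K ∧ l < k then L k * h (n + k) ^ 3 / 2 * ∏ t ∈ Ico (n + 1 + l) (n + k + 1), g t else 0)
    {KA : ℕ → ℕ → ℕ → ℝ} {RA : ℕ → (ℕ → ℝ) → ℕ → ℝ}
    (hRA : ∀ i v m, RA i v m = ∑ l ∈ range K, KA i m l * v (m + 1 + l))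
    (hKA : ∀ i m l, KA i m l = KL i m l + KA (i + 1) m l) (hKAtop : ∀ m l, KA K m l = 0)
    {e ε : ℕ → ℝ} (he0 : ∀ m, 0 ≤ e m) (hea : ∀ m, e (m + 1) ≤ e m)
    (hεt : ∀ m, N < m → ε m = 0) (hεrec : ∀ m, ε m = e m - RA 1 ε m) : ∀ m, 0 ≤ ε m ∧ ε m ≤ e m := by
  by_cases h29 : a 0 ≤ 29
  · exact flow_nonneg_young_pair_cap_separated_ages hmono hL hb hlo hdom hh hf hg hgF hr ha0 h29 haK
      (fun j hj => le_trans (Nat.mul_le_mul_right _ (by norm_num)) (hsep j hj)) hLa hKL hRA hKA hKAtop he0 hea hεt hεrec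
  · have h30 : 30 ≤ a 0 := by omega
    obtain ⟨at', hat'⟩ : ∃ at' : ℕ → ℕ, ∀ i, at' i = if i = 0 then 1 else a (i - 1) := ⟨_, fun _ => rfl⟩
    have hat0 : at' 0 = 1 := by rw [hat']; simp
    have hatS : ∀ j, at' (j + 1) = a j := fun j => by rw [hat']; simp
    have hat1 : at' 1 = a 0 := by rw [hat']; simp
    refine flow_nonneg_youngest_separated_ages hmono hL hb hlo hdom hh hf hg hgF (r := r + 1) (a := at') (by omega) (le_of_eq hat0.symm)
      (by rw [show r + 1 - 1 = (r - 1) + 1 by omega, hatS]; exact haK) (fun _ => by rw [hat0, hat1]; omega)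
      (fun j hj1 hjr => ?_) (fun l hl hne => ?_) hKL hRA hKA hKAtop he0 hea hεt hεrec
    · obtain ⟨i, rfl⟩ : ∃ i, j = i + 1 := ⟨j - 1, by omega⟩
      rw [hatS, hatS]
      exact hsep i (by omega)
    · exact hLa l hl (by have := hne 0 (by omega); rwa [hat0] at this) fun j hj => by
        have := hne (j + 1) (by omega); rwa [hatS] at this

/-- **THE CENSUS FOUR AGES `{1, k₂, k₃, k₄}` WITH ANY `k₂` AND RATIOS ≥ 61 ABOVE** (`2 ≤ k₂`, `k₃ ≥ 61k₂`, `k₄ ≥ 61k₃`, `k₄ < K`). [folklore] -/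
theorem flow_nonneg_census_four_ages_sixtyone
    (hmono : ∀ u v : ℕ → ℝ, SeqBox γ u → SeqBox γ v → (∀ j, u j ≤ v j) → B u ≤ B v)
    (hL : ∀ k, 0 ≤ L k) (hb : 0 < b) (hlo : ∀ u, SeqBox γ u → b ≤ B u) (hdom : ∀ u, SeqBox γ u → ∑ k ∈ range K, L k * u k ≤ B u)
    (hh : SeqBox γ h) (hf : MemFlow B gIR h) (hg : ∀ t, 0 < g t ∧ g t ≤ 1)
    (hgF : ∀ t, 1 ≤ g t * (1 + ∑ k ∈ range K, L k * h (t + k) ^ 3 / 2))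
    {k₂ k₃ k₄ : ℕ} (hk2 : 2 ≤ k₂) (hk3 : 61 * k₂ ≤ k₃) (hk4 : 61 * k₃ ≤ k₄) (hk4K : k₄ < K)
    (hL4 : ∀ j, j < K → j ≠ 1 → j ≠ k₂ → j ≠ k₃ → j ≠ k₄ → L j = 0)
    {N : ℕ} {KL : ℕ → ℕ → ℕ → ℝ}
    (hKL : ∀ k n l, KL k n l = if 0 < k ∧ k < K ∧ l < k then L k * h (n + k) ^ 3 / 2 * ∏ t ∈ Ico (n + 1 + l) (n + k + 1), g t else 0)
    {KA : ℕ → ℕ → ℕ → ℝ} {RA : ℕ → (ℕ → ℝ) → ℕ → ℝ}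
    (hRA : ∀ i v m, RA i v m = ∑ l ∈ range K, KA i m l * v (m + 1 + l))
    (hKA : ∀ i m l, KA i m l = KL i m l + KA (i + 1) m l) (hKAtop : ∀ m l, KA K m l = 0)
    {e ε : ℕ → ℝ} (he0 : ∀ m, 0 ≤ e m) (hea : ∀ m, e (m + 1) ≤ e m)
    (hεt : ∀ m, N < m → ε m = 0) (hεrec : ∀ m, ε m = e m - RA 1 ε m) : ∀ m, 0 ≤ ε m ∧ ε m ≤ e m := by
  refine flow_nonneg_census_young_pair_every_sixtyone hmono hL hb hlo hdom hh hf hg hgF (r := 3)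
    (a := fun j => if j = 0 then k₂ else if j = 1 then k₃ else k₄) (by norm_num) (by simpa using hk2)
    (by simpa using hk4K) (fun j hj => ?_) (fun l hl hl1 hla => hL4 l hl hl1 ?_ ?_ ?_) hKL hRA hKA hKAtop he0 hea hεt hεrec
  · have : j = 0 ∨ j = 1 := by omega
    rcases this with rfl | rfl <;> simp <;> omega
  · simpa using hla 0 (by norm_num)
  · simpa using hla 1 (by norm_num)
  · simpa using hla 2 (by norm_num)

end Summit.QuantumFields.BalabanUV.Beta.EriceRemainderEnclosureHistoryAutonomyComparisonAgeCompositionYoungPairCapSeparatedAges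

end
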